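import Summits.AtomisticToContinuum.HydrodynamicLimit.Theorems.CollisionIsometryCLTAdaptedWeightCLTCBEqRungCore
import Summits.AtomisticToContinuum.HydrodynamicLimit.Theorems.CollisionIsometryCLTAdaptedWeightCLTCBFreeStretch

/-!
# Equilibrium rung of the crux `AdaptedWeightCLT` (stmt-AtomisticToContinuum-14868), line `Sketch`:
# the block moments at fixed positions under independent Gaussian velocities

Support file (`--supports stmt-AtomisticToContinuum-14868`, anchor `eqRung_zip_anchor`) of the line lead
`prover-line-stmt-AtomisticToContinuum-14868-c3-0`; third file of the EQUILIBRIUM RUNG. It connects the crux's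
configuration-level block moments `blkC` (hence `defectC = Σ D² + |q|²`, `anisC = ∫ₓ defectC`) to the abstract
block functional of `…CBEqRungCore`:

* at a zipped configuration `zipConfig (p, v)` with block weights `wᵢ = φ_N(pᵢ − x)`, `W = Σ wᵢ ≠ 0`,
  `blkC r C' = (W/(N+1)) · Σᵢ (wᵢ/W) ⟨C', (vᵢ − u − η)^{⊗r}⟩`, `η = Σ (wᵢ/W)(vᵢ − u)` (`blkC_zipConfig`), and
  `blkC = 0` on an empty block (`blkC_zipConfig_eq_zero`);
* the block defect is jointly measurable in `(z, x)` and the block anisotropy is measurable in `z`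
  (`measurable_defectC_prod`, `measurable_anisC`);
* the static bound for ONE test at fixed positions under `⊗ N(u, θ𝟙)`:
  `E (blkC C')² ≤ (W/(N+1))² · Bnd_k(s)`, `s = Σ (wᵢ/W)²` (`lintegral_blkC_sq_zip_le`, from `lintegral_F_sq_le`);
* the rate bookkeeping: `Bnd_k(s) = O(s^{1/4})` on `s ≤ 1` (`core_shape_real_le`) and the density-cap algebra
  `(W/M)² s^{1/4} ≤ (Dcap + 1)² (w_max/M)^{1/4}` when `W/M ≤ Dcap`, `s ≤ w_max/W` (`cap_bookkeeping`).

No definitions are introduced (pure proof file).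

References: H. Spohn, *Large Scale Dynamics of Interacting Particles* (1991), Part I §2.3 [Spohn1991].
-/

namespace Summit.AtomisticToContinuum.HydrodynamicLimit.Theorems.ContactBalance

open scoped BigOperators Topology Classical MeasureTheory ENNReal InnerProductSpace
open Filter Set MeasureTheory ProbabilityTheory
open Literature.Analysis.FluidPDE
open Summit.AtomisticToContinuum.HydrodynamicLimit.Theorems.ContactSourceDuhamel
open Summit.AtomisticToContinuum.HydrodynamicLimit.Theorems.ContactSourceDuhamel.TimeLocal
open Literature.MathematicalPhysics.KineticTheory (gaussMeasure zipConfig zipConfig_apply)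

noncomputable section

namespace EqRung

/-! ## The block moments at a zipped configuration -/

section Zip

variable {N : ℕ} (φ : ℕ → T3 → ℝ) (p : Fin (N + 1) → T3) (x : T3) (u : V3)

/-- The block weights of `zipConfig (p, v)` are `φ_N(pᵢ − x)` (velocity-free). -/
theorem wgtC_zipConfig (v : Fin (N + 1) → V3) (i : Fin (N + 1)) :
    wgtC N φ (zipConfig (p, v)) x i = φ N (p i - x) := by
  simp [wgtC, zipConfig_apply]

/-- The weighted velocity average: `W⁻¹ Σ wⱼ vⱼ = u + Σ (wⱼ/W)(vⱼ − u)` for `W = Σ wⱼ ≠ 0`. -/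
theorem inv_smul_sum_smul_eq {w : Fin (N + 1) → ℝ} (hW : ∑ j, w j ≠ 0) (v : Fin (N + 1) → V3) :
    (∑ j, w j)⁻¹ • ∑ j, w j • v j = u + ∑ j, (w j / ∑ j, w j) • (v j - u) := by
  have h1 : ∑ j, (w j / ∑ j, w j) • (v j - u) =
      (∑ j, w j)⁻¹ • ∑ j, w j • v j - (∑ j, w j / ∑ j, w j) • u := by
    rw [Finset.sum_smul, Finset.smul_sum, ← Finset.sum_sub_distrib]
    refine Finset.sum_congr rfl fun j _ => ?_
    rw [smul_sub, div_eq_inv_mul, mul_smul]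
  rw [h1, ← Finset.sum_div, div_self hW, one_smul]
  abel

/-- At a zipped configuration with `W = Σ φ_N(pᵢ − x) ≠ 0`, the block moment of the test `C'` is
`(W/(N+1)) Σᵢ (wᵢ/W) ⟨C', (vᵢ − u − η)^{⊗r}⟩` with `η = Σ (wᵢ/W)(vᵢ − u)`. -/
theorem blkC_zipConfig {r : ℕ} (C' : Tens r) (v : Fin (N + 1) → V3) (hW : ∑ j, φ N (p j - x) ≠ 0) :
    blkC r N φ (zipConfig (p, v)) x C' =
      ((∑ j, φ N (p j - x)) / ((N + 1 : ℕ) : ℝ)) *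
        ∑ i, (φ N (p i - x) / ∑ j, φ N (p j - x)) *
          pairT C' (tpow r (v i - u - ∑ j, (φ N (p j - x) / ∑ j, φ N (p j - x)) • (v j - u))) := by
  have hub : ubarC N φ (zipConfig (p, v)) x = u + ∑ j, (φ N (p j - x) / ∑ j, φ N (p j - x)) • (v j - u) := by
    rw [Pointwise.ubarC_eq]
    simp_rw [wgtC_zipConfig]
    simp only [zipConfig_apply]
    exact inv_smul_sum_smul_eq u hW v
  unfold blkC
  simp_rw [wgtC_zipConfig, hub]
  simp only [zipConfig_apply]
  rw [Finset.mul_sum, Finset.mul_sum]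
  refine Finset.sum_congr rfl fun i _ => ?_
  have : (∑ j, φ N (p j - x)) / ((N + 1 : ℕ) : ℝ) * (φ N (p i - x) / ∑ j, φ N (p j - x)) =
      ((N + 1 : ℕ) : ℝ)⁻¹ * φ N (p i - x) := by
    field_simp
  rw [← sub_sub, ← mul_assoc, ← this, mul_assoc]

/-- If all block weights vanish, the block moments vanish. -/
theorem blkC_zipConfig_eq_zero {r : ℕ} (C' : Tens r) (v : Fin (N + 1) → V3) (h0 : ∀ i, φ N (p i - x) = 0) :
    blkC r N φ (zipConfig (p, v)) x C' = 0 := by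
  unfold blkC
  simp_rw [wgtC_zipConfig, h0]
  simp

end Zip

/-! ## Measurability of the block defect in the configuration -/

section Measurability

variable {N : ℕ} {φ : ℕ → T3 → ℝ}

/-- The block weights are jointly measurable in `(z, x)`. -/
theorem measurable_wgtC_prod (hφc : Continuous (φ N)) (i : Fin (N + 1)) :
    Measurable fun q : Cfg N × T3 => wgtC N φ q.1 q.2 i := by
  unfold wgtC
  exact hφc.measurable.comp
    (((Geometry.IsMeasurable.measurable_pos i).comp measurable_fst).sub measurable_snd)

/-- The block velocity is jointly measurable in `(z, x)`. -/
theorem measurable_ubarC_prod (hφc : Continuous (φ N)) :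
    Measurable fun q : Cfg N × T3 => ubarC N φ q.1 q.2 := by
  have h : (fun q : Cfg N × T3 => ubarC N φ q.1 q.2) =
      fun q => (∑ i, wgtC N φ q.1 q.2 i)⁻¹ • ∑ i, wgtC N φ q.1 q.2 i • (q.1 i).2 :=
    funext fun q => Pointwise.ubarC_eq N φ q.1 q.2
  rw [h]
  refine (Finset.measurable_sum _ fun i _ => measurable_wgtC_prod hφc i).inv.smul
    (Finset.measurable_sum _ fun i _ => (measurable_wgtC_prod hφc i).smul ?_)
  exact (Geometry.IsMeasurable.measurable_vel i).comp measurable_fst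

/-- The block moments are jointly measurable in `(z, x)`. -/
theorem measurable_blkC_prod {r : ℕ} (hφc : Continuous (φ N)) (C' : Tens r) :
    Measurable fun q : Cfg N × T3 => blkC r N φ q.1 q.2 C' := by
  unfold blkC
  refine (Finset.measurable_sum _ fun i _ => ?_).const_mul _
  exact (measurable_wgtC_prod hφc i).mul (Reduction.measurable_pairT C'
    (Reduction.measurable_tpow (((Geometry.IsMeasurable.measurable_vel i).comp measurable_fst).sub
      (measurable_ubarC_prod hφc))))

/-- The block defect `Σ D² + |q|²` is jointly measurable in `(z, x)`. -/
theorem measurable_defectC_prod (hφc : Continuous (φ N)) :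
    Measurable fun q : Cfg N × T3 => defectC N φ q.1 q.2 := by
  unfold defectC
  exact (Finset.measurable_sum _ fun j _ => Finset.measurable_sum _ fun k _ =>
    (measurable_blkC_prod hφc (C2 j k)).pow_const 2).add
    (Finset.measurable_sum _ fun a _ => (measurable_blkC_prod hφc (C3 a)).pow_const 2)

/-- The block anisotropy `anis(z) = ∫ₓ Σ D² + |q|²` is measurable in the configuration. -/
theorem measurable_anisC (hφc : Continuous (φ N)) : Measurable fun z : Cfg N => anisC N φ z := by
  have h := (measurable_defectC_prod hφc).stronglyMeasurable.integral_prod_right' (ν := (volume : Measure T3))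
  exact h.measurable

end Measurability

/-! ## The static bound for one test at fixed positions: velocities `⊗ N(u, θ𝟙)` -/

section Fixed

variable (u : V3) {θ : ℝ} {N : ℕ} {φ : ℕ → T3 → ℝ}

/-- The test functionals `y ↦ ⟨C', y^{⊗r}⟩` are continuous (polynomials in the coordinates). -/
theorem continuous_pairT_tpow {r : ℕ} (C' : Tens r) : Continuous fun y : V3 => pairT C' (tpow r y) := by
  unfold pairT tpow
  fun_prop

/-- The weight ratios of a nonempty block are convex weights with `Σ (wᵢ/W)² ≤ 1` and `≤ w_max/W`. -/
theorem ratios_props {w : Fin (N + 1) → ℝ} (hw0 : ∀ i, 0 ≤ w i) (hW : ∑ j, w j ≠ 0) {wcap : ℝ}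
    (hwc : ∀ i, w i ≤ wcap) :
    (∀ i, 0 ≤ w i / ∑ j, w j) ∧ (∑ i, w i / ∑ j, w j) = 1 ∧
      (∑ i, (w i / ∑ j, w j) ^ 2) ≤ 1 ∧ (∑ i, (w i / ∑ j, w j) ^ 2) ≤ wcap / ∑ j, w j := by
  have hWpos : 0 < ∑ j, w j := lt_of_le_of_ne (Finset.sum_nonneg fun j _ => hw0 j) (Ne.symm hW)
  have hc0 : ∀ i, 0 ≤ w i / ∑ j, w j := fun i => div_nonneg (hw0 i) hWpos.le
  have hc1 : (∑ i, w i / ∑ j, w j) = 1 := by rw [← Finset.sum_div, div_self hW]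
  have hle1 : ∀ i, w i / ∑ j, w j ≤ 1 := fun i =>
    (div_le_one hWpos).2 (Finset.single_le_sum (fun j _ => hw0 j) (Finset.mem_univ i))
  have hlec : ∀ i, w i / ∑ j, w j ≤ wcap / ∑ j, w j := fun i =>
    div_le_div_of_nonneg_right (hwc i) hWpos.le
  refine ⟨hc0, hc1, ?_, ?_⟩
  · calc (∑ i, (w i / ∑ j, w j) ^ 2) ≤ ∑ i, w i / ∑ j, w j :=
          Finset.sum_le_sum fun i _ => by
            rw [sq]; exact mul_le_of_le_one_left (hc0 i) (hle1 i)
      _ = 1 := hc1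
  · calc (∑ i, (w i / ∑ j, w j) ^ 2) ≤ ∑ i, (w i / ∑ j, w j) * (wcap / ∑ j, w j) :=
          Finset.sum_le_sum fun i _ => by
            rw [sq]; exact mul_le_mul_of_nonneg_left (hlec i) (hc0 i)
      _ = wcap / ∑ j, w j := by rw [← Finset.sum_mul, hc1, one_mul]

/-- The static bound for ONE test at fixed positions: `E (blkC C')² ≤ (W/(N+1))² · Bnd_k(s)` where `Bnd_k(s)`
is the core bound of `…CBEqRungCore` for the centred test `y ↦ ⟨C', y^{⊗r}⟩` of degree `k + 1`. -/
theorem lintegral_blkC_sq_zip_le (hθ : 0 < θ) {r : ℕ} (C' : Tens r) {k : ℕ}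
    (hf0 : ∀ y, |pairT C' (tpow r y)| ≤ 2 * ‖y‖ ^ (k + 1))
    (hf1 : ∀ y y', |pairT C' (tpow r y') - pairT C' (tpow r y)| ≤ 2 * ‖y' - y‖ * (‖y'‖ + ‖y‖) ^ k)
    (hmean : ∫ w, pairT C' (tpow r (w - u)) ∂gaussMeasure u θ = 0)
    (hφ0 : ∀ y, 0 ≤ φ N y) (p : Fin (N + 1) → T3) (x : T3) :
    ∫⁻ v, ENNReal.ofReal (blkC r N φ (zipConfig (p, v)) x C' ^ 2) ∂(Measure.pi fun _ : Fin (N + 1) => gaussMeasure u θ) ≤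
      ENNReal.ofReal (((∑ j, φ N (p j - x)) / ((N + 1 : ℕ) : ℝ)) ^ 2) *
        (2 * ENNReal.ofReal (4 * (∫ w, ‖w - u‖ ^ (2 * (k + 1)) ∂gaussMeasure u θ) *
            ∑ i, (φ N (p i - x) / ∑ j, φ N (p j - x)) ^ 2) +
          2 * (ENNReal.ofReal (16 * 9 ^ k) *
            ((ENNReal.ofReal (3 * θ * ∑ i, (φ N (p i - x) / ∑ j, φ N (p j - x)) ^ 2) ^ (1 / 2 : ℝ) *
                ENNReal.ofReal (∫ w, ‖w - u‖ ^ 6 ∂gaussMeasure u θ) ^ (1 / 2 : ℝ)) ^ (1 / 2 : ℝ) *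
              ENNReal.ofReal (∫ w, ‖w - u‖ ^ (k * 4) ∂gaussMeasure u θ) ^ (1 / 2 : ℝ)))) := by
  by_cases hW : ∑ j, φ N (p j - x) = 0
  · -- all weights vanish: the block moment is zero
    have h0 : ∀ i, φ N (p i - x) = 0 := fun i =>
      (Finset.sum_eq_zero_iff_of_nonneg fun j _ => hφ0 (p j - x)).1 hW i (Finset.mem_univ i)
    simp_rw [blkC_zipConfig_eq_zero φ p x C' _ h0]
    simp
  -- convex weights, the core bound
  set c : Fin (N + 1) → ℝ := fun i => φ N (p i - x) / ∑ j, φ N (p j - x) with hc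
  have hc0 : ∀ i, 0 ≤ c i := fun i => div_nonneg (hφ0 _) (Finset.sum_nonneg fun j _ => hφ0 _)
  have hc1 : ∑ i, c i = 1 := by
    show (∑ i, φ N (p i - x) / ∑ j, φ N (p j - x)) = 1
    rw [← Finset.sum_div, div_self hW]
  have hcont : Continuous fun y : V3 => pairT C' (tpow r y) := continuous_pairT_tpow C'
  have hcore := lintegral_F_sq_le u θ c (f := fun y => pairT C' (tpow r y))
    (fun v => ∑ i, c i • (v i - u)) (fun m v => ∑ i, c i * ‖v i - u‖ ^ m)
    (fun v => ∑ i, c i * pairT C' (tpow r (v i - u - ∑ i, c i • (v i - u))))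
    (fun v => ∑ i, c i * pairT C' (tpow r (v i - u)))
    hc0 hc1 rfl rfl rfl rfl hcont hf0 hf1 hθ hmean
  -- `blkC² = (W/M)² F²`
  have hblk : ∀ v : Fin (N + 1) → V3, blkC r N φ (zipConfig (p, v)) x C' ^ 2 =
      ((∑ j, φ N (p j - x)) / ((N + 1 : ℕ) : ℝ)) ^ 2 *
        (∑ i, c i * pairT C' (tpow r (v i - u - ∑ i, c i • (v i - u)))) ^ 2 := by
    intro v
    rw [blkC_zipConfig φ p x u C' v hW, mul_pow]
  have hmeasF : Measurable fun v : Fin (N + 1) → V3 =>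
      ENNReal.ofReal ((∑ i, c i * pairT C' (tpow r (v i - u - ∑ i, c i • (v i - u)))) ^ 2) := by
    have : Continuous fun v : Fin (N + 1) → V3 =>
        (∑ i, c i * pairT C' (tpow r (v i - u - ∑ i, c i • (v i - u)))) ^ 2 := by
      refine (continuous_finsetSum _ fun i _ => continuous_const.mul (hcont.comp ?_)).pow 2
      fun_prop
    exact this.measurable.ennreal_ofReal
  simp_rw [hblk]
  have hnn : (0 : ℝ) ≤ ((∑ j, φ N (p j - x)) / ((N + 1 : ℕ) : ℝ)) ^ 2 := sq_nonneg _
  simp_rw [ENNReal.ofReal_mul hnn]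
  rw [lintegral_const_mul _ hmeasF]
  exact mul_le_mul_right hcore _

end Fixed

/-! ## From `s = Σ (wᵢ/W)²` to the uniform rate -/

section Rate

/-- `x ≤ x^{1/4}` on `[0, 1]` in `ℝ≥0∞`. -/
theorem le_rpow_quarter {x : ℝ≥0∞} (hx : x ≤ 1) : x ≤ x ^ (1 / 4 : ℝ) := by
  have h := ENNReal.rpow_le_rpow_of_exponent_ge hx (by norm_num : (1 / 4 : ℝ) ≤ 1)
  rwa [ENNReal.rpow_one] at h

/-- `((a x)^{1/2} b^{1/2})^{1/2} = a^{1/4} b^{1/4} x^{1/4}` in `ℝ≥0∞`. -/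
theorem sqrt_sqrt_mul_eq (a b x : ℝ≥0∞) :
    ((a * x) ^ (1 / 2 : ℝ) * b ^ (1 / 2 : ℝ)) ^ (1 / 2 : ℝ) =
      a ^ (1 / 4 : ℝ) * b ^ (1 / 4 : ℝ) * x ^ (1 / 4 : ℝ) := by
  have h2 : (0 : ℝ) ≤ 1 / 2 := by norm_num
  rw [ENNReal.mul_rpow_of_nonneg _ _ h2, ENNReal.mul_rpow_of_nonneg _ _ h2, ENNReal.mul_rpow_of_nonneg _ _ h2,
    ← ENNReal.rpow_mul, ← ENNReal.rpow_mul, ← ENNReal.rpow_mul]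
  norm_num
  ring

/-- The core bound is `O(s^{1/4})`: for `s ≤ 1` in `ℝ≥0∞`,
`2 (A s) + 2 (B ((c s)^{1/2} m₆^{1/2})^{1/2} m^{1/2}) ≤ (2A + 2 B c^{1/4} m₆^{1/4} m^{1/2}) s^{1/4}`. -/
theorem core_shape_le (A B c m6 m s : ℝ≥0∞) (hs : s ≤ 1) :
    2 * (A * s) + 2 * (B * (((c * s) ^ (1 / 2 : ℝ) * m6 ^ (1 / 2 : ℝ)) ^ (1 / 2 : ℝ) * m ^ (1 / 2 : ℝ))) ≤
      (2 * A + 2 * B * c ^ (1 / 4 : ℝ) * m6 ^ (1 / 4 : ℝ) * m ^ (1 / 2 : ℝ)) * s ^ (1 / 4 : ℝ) := by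
  rw [sqrt_sqrt_mul_eq, add_mul]
  gcongr ?_ + ?_
  · rw [mul_assoc]
    exact mul_le_mul_right (mul_le_mul_right (le_rpow_quarter hs) _) _
  · apply le_of_eq; ring

/-- The same in the REAL-input shape produced by `lintegral_blkC_sq_zip_le` (degree `k + 1`, `0 ≤ s ≤ 1`). -/
theorem core_shape_real_le (u : V3) {θ : ℝ} (hθ : 0 < θ) (k : ℕ) {s : ℝ} (hs1 : s ≤ 1) :
    2 * ENNReal.ofReal (4 * (∫ w, ‖w - u‖ ^ (2 * (k + 1)) ∂gaussMeasure u θ) * s) +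
        2 * (ENNReal.ofReal (16 * 9 ^ k) *
          ((ENNReal.ofReal (3 * θ * s) ^ (1 / 2 : ℝ) *
              ENNReal.ofReal (∫ w, ‖w - u‖ ^ 6 ∂gaussMeasure u θ) ^ (1 / 2 : ℝ)) ^ (1 / 2 : ℝ) *
            ENNReal.ofReal (∫ w, ‖w - u‖ ^ (k * 4) ∂gaussMeasure u θ) ^ (1 / 2 : ℝ))) ≤
      (2 * ENNReal.ofReal (4 * ∫ w, ‖w - u‖ ^ (2 * (k + 1)) ∂gaussMeasure u θ) +
          2 * ENNReal.ofReal (16 * 9 ^ k) * ENNReal.ofReal (3 * θ) ^ (1 / 4 : ℝ) *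
            ENNReal.ofReal (∫ w, ‖w - u‖ ^ 6 ∂gaussMeasure u θ) ^ (1 / 4 : ℝ) *
              ENNReal.ofReal (∫ w, ‖w - u‖ ^ (k * 4) ∂gaussMeasure u θ) ^ (1 / 2 : ℝ)) *
        ENNReal.ofReal s ^ (1 / 4 : ℝ) := by
  have h4 : (0 : ℝ) ≤ 4 * ∫ w, ‖w - u‖ ^ (2 * (k + 1)) ∂gaussMeasure u θ :=
    mul_nonneg (by norm_num) (integral_norm_sub_pow_nonneg u θ _)
  have h3 : (0 : ℝ) ≤ 3 * θ := by positivity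
  rw [ENNReal.ofReal_mul h4, ENNReal.ofReal_mul h3]
  exact core_shape_le _ _ _ _ _ _ (ENNReal.ofReal_le_one.2 hs1)

/-- The real bookkeeping of the density cap: for `0 < W`, `W/M ≤ Dcap`, `0 ≤ s ≤ wcap/W`:
`(W/M)² s^{1/4} ≤ (Dcap + 1)² (wcap/M)^{1/4}`. -/
theorem cap_bookkeeping {W M Dcap wcap s : ℝ} (hM : 0 < M) (hW : 0 < W) (hWM : W / M ≤ Dcap)
    (hwcap : 0 ≤ wcap) (hs0 : 0 ≤ s) (hs : s ≤ wcap / W) :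
    (W / M) ^ 2 * s ^ (1 / 4 : ℝ) ≤ (Dcap + 1) ^ 2 * (wcap / M) ^ (1 / 4 : ℝ) := by
  have ht : 0 < W / M := div_pos hW hM
  have hq : (0 : ℝ) ≤ 1 / 4 := by norm_num
  -- `s^{1/4} ≤ (wcap/W)^{1/4} = (wcap/M)^{1/4} (W/M)^{-1/4}`
  have h1 : s ^ (1 / 4 : ℝ) ≤ (wcap / W) ^ (1 / 4 : ℝ) := Real.rpow_le_rpow hs0 hs hq
  have h2 : (wcap / W) ^ (1 / 4 : ℝ) = (wcap / M) ^ (1 / 4 : ℝ) * (W / M) ^ (-(1 / 4) : ℝ) := by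
    rw [Real.rpow_neg ht.le, ← Real.inv_rpow ht.le, ← Real.mul_rpow (div_nonneg hwcap hM.le) (inv_nonneg.2 ht.le)]
    congr 1
    field_simp
  -- `(W/M)² (W/M)^{-1/4} = (W/M)^{7/4} ≤ (Dcap+1)^{7/4} ≤ (Dcap+1)²`
  have h3 : (W / M) ^ 2 * (W / M) ^ (-(1 / 4) : ℝ) = (W / M) ^ (7 / 4 : ℝ) := by
    rw [← Real.rpow_natCast, ← Real.rpow_add ht]
    norm_num
  have h4 : (W / M) ^ (7 / 4 : ℝ) ≤ (Dcap + 1) ^ 2 := by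
    calc (W / M) ^ (7 / 4 : ℝ) ≤ (Dcap + 1) ^ (7 / 4 : ℝ) :=
          Real.rpow_le_rpow ht.le (by linarith) (by norm_num)
      _ ≤ (Dcap + 1) ^ (2 : ℝ) := Real.rpow_le_rpow_of_exponent_le (by linarith) (by norm_num)
      _ = (Dcap + 1) ^ 2 := by rw [Real.rpow_two]
  have h5 : 0 ≤ (wcap / M) ^ (1 / 4 : ℝ) := Real.rpow_nonneg (div_nonneg hwcap hM.le) _
  calc (W / M) ^ 2 * s ^ (1 / 4 : ℝ) ≤ (W / M) ^ 2 * (wcap / W) ^ (1 / 4 : ℝ) :=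
        mul_le_mul_of_nonneg_left h1 (sq_nonneg _)
    _ = ((W / M) ^ 2 * (W / M) ^ (-(1 / 4) : ℝ)) * (wcap / M) ^ (1 / 4 : ℝ) := by rw [h2]; ring
    _ = (W / M) ^ (7 / 4 : ℝ) * (wcap / M) ^ (1 / 4 : ℝ) := by rw [h3]
    _ ≤ (Dcap + 1) ^ 2 * (wcap / M) ^ (1 / 4 : ℝ) := mul_le_mul_of_nonneg_right h4 h5

end Rate

/-! ## Registered anchor of this support file -/

/-- ANCHOR (registered helper stub `eqRung_zip_anchor` of the crux item): the block weights of a zipped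
configuration are the velocity-free kernel values `φ_N(pᵢ − x)` — the entry point of the disintegration
of the local Gibbs law into positions and Gaussian velocities for the crux's block functional. -/
theorem eqRung_zip_anchor : ∀ (N : ℕ) (φ : ℕ → T3 → ℝ) (p : Fin (N + 1) → T3) (x : T3) (v : Fin (N + 1) → V3) (i : Fin (N + 1)), wgtC N φ (Literature.MathematicalPhysics.KineticTheory.zipConfig (p, v)) x i = φ N (p i - x) :=
  fun _ φ p x v i => wgtC_zipConfig φ p x v i

end EqRung

end

end Summit.AtomisticToContinuum.HydrodynamicLimit.Theorems.ContactBalance
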